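import Summits.QuantumFields.BalabanUV.Beta.FP.InducedPolarizationLoops

/-!
# `BalabanUV.Beta.FP.InducedPolarizationRegroup` — road «FP» for binder row D1, row **RHOA-2 (§-sequel asked by the owner, «GO» ×6 (4),
# journal 2026-08-20T23:53Z)**: the SUBSTITUTION STEP of the L-sector regrouping of N7-PROOF v3.3 §2(a) — the pure-`H` parts of the C-jets
# turn the coarse-Gram leg `Ξ` of `InducedPolarizationLSector` into its fine image `R̃ := A·Ξ·Aᵀ`, producing exactly the `R̃`-loops that the
# generic regrouping letter (row RHOA-10b, `FP/InducedGaugeFixing.gluonLoops_regroup`, another seat) combines into `½tr((Γ₀+R̃)Ḣ(Γ₀+R̃)Ḣ) − ½tr((Γ₀+R̃)Ḧ)`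

HONEST DEPENDENCY (cell records, verbatim): «continuum YM on T⁴ ⇐ BetaPertH ∧ nine spine estimates (0/9 proved); BetaPertH ⇐ (D1) ∧ (D4) ∧
CAP+tail; G-an2-4 gates asym, D1 and NE2/3/4.»  HONEST FRAMING (cell contract, verbatim): «discharging `BetaPertH` makes Bałaban's UV stability
UNCONDITIONAL — a real constructive-QFT result; it is NOT the continuum limit and NOT the Clay problem.»  THIS MODULE is [folklore] matrix algebra
(trace cyclicity) over ABSTRACT matrices; NO estimate, NO lattice object, nothing of Bałaban's manuscripts, no definition, no `def … : Prop`,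
nothing cited, 0 sorry.  It discharges NOTHING of `hbook`∕`hasym`∕D1.  NOT D1, NOT BetaPertH, NOT continuum, NOT Clay.

ABSOLUTE RULE (cell charter, verbatim): «No internally-minted statement may enter as a cited fact. Every hypothesis is either kernel-proved in this
package or a verbatim quotation of a PUBLISHED theorem with page reference. The manuscript(s) under audit are NOT citable for their own disputed
steps — they are the thing under adjudication; programme-internal (2001/route/tribunal) claims are never citable.»

WHERE THIS SITS.  `FP/InducedPolarizationLoops.secondVar_blockProp_jets` ends in the pure-`H` C-sector loops
`2tr(R^QḢPḢ) − tr(R^QḢR^QḢ) − tr(R^QḦ)` and `oneShot_regroup` turns `T¹` minus HALF of them into `½tr(Γ₀ḢΓ₀Ḣ) − ½tr(Γ₀Ḧ)`;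
`FP/InducedPolarizationLSector.secondVar_gram_jets` ends in the C-jet loops of the L-sector `−tr(ΞC₂) + 2tr(ΞC₁GC₁) − tr(ΞC₁ΞC₁)`, whose pure-`H`
parts are obtained by substituting the pure-`H` parts of the C-jets, `C₁ʰ = −(QP)Ḣ(PQᵀ)`, `C₂ʰ = 2(QP)ḢPḢ(PQᵀ) − (QP)Ḧ(PQᵀ)`.  THIS FILE: for ANY
`μ × μ` matrix `Ξ` (on the road `Ξ = G_C d^c L_C⁻¹ d^{cT} G_C`), with `A = H⁻¹Qᵀ`, `R̃ := A·Ξ·(QP)` written out, those pure-`H` L-sector loops read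
`−2tr(R̃ḢPḢ) + tr(R̃Ḧ) + 2tr(R̃ḢR^QḢ) − tr(R̃ḢR̃Ḣ)` in fine legs (**`lsector_pureH_eq`**; `R^Q = minMap·Q·H⁻¹`).  The GENERIC regrouping letter
(«for any `R̃`: `T¹ − ½[C pure H] − ½[L pure H in R̃-dress] = ½tr((Γ₀+R̃)Ḣ(Γ₀+R̃)Ḣ) − ½tr((Γ₀+R̃)Ḧ)`») is row RHOA-10b's (journal
2026-08-21T00:08Z ∕ 00:15Z) and is NOT restated here; `InducedPolarizationLoops.oneShot_regroup` is its `R̃ = 0` instance (memo §2 (ii) CHECK).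
Only trace cyclicity is used: no symmetry, no invertibility hypothesis.
Provenance: D1 formalisation swarm leaf seat `b2b-balaban-beta-d1-formalise-leaf-05` gen 11 (road «FP» row RHOA-2 sequel), 2026-08-21.
-/

noncomputable section

namespace Summit.QuantumFields.BalabanUV.Beta.FP.InducedPolarizationRegroup

open Matrix
open Literature.MathematicalPhysics.QuantumFieldTheory.Balaban1983to89.Beta.Composition (blockProp)
open Literature.MathematicalPhysics.QuantumFieldTheory.Balaban1983to89.Beta.Envelope (minMap)
open Summit.QuantumFields.BalabanUV.Beta.FP.InducedPolarizationLoops (range_term_eq)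

variable {ν μ : Type*} [Fintype ν] [Fintype μ] [DecidableEq ν] [DecidableEq μ]

omit [DecidableEq μ] in
/-- [folklore] `tr(Ξ·(QP)·X·(PQᵀ)) = tr(R̃·X)` with `R̃ = (PQᵀ)·Ξ·(QP)`: a coarse leg sandwiched between the averaging maps is a fine leg. -/
theorem trace_xi_sandwich (H : Matrix ν ν ℝ) (Q : Matrix μ ν ℝ) (Ξ : Matrix μ μ ℝ) (X : Matrix ν ν ℝ) :
    (Ξ * ((Q * H⁻¹) * X * (H⁻¹ * Qᵀ))).trace = (H⁻¹ * Qᵀ * Ξ * (Q * H⁻¹) * X).trace := by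
  rw [show Ξ * ((Q * H⁻¹) * X * (H⁻¹ * Qᵀ)) = (Ξ * (Q * H⁻¹) * X) * (H⁻¹ * Qᵀ) by simp only [Matrix.mul_assoc], Matrix.trace_mul_comm]
  simp only [Matrix.mul_assoc]

/-- [folklore] **THE PURE-`H` L-SECTOR LOOPS IN FINE LEGS.**  Substituting the pure-`H` parts of the C-jets, `C₁ʰ = −(QP)Ḣ(PQᵀ)` and
`C₂ʰ = 2•(QP)ḢPḢ(PQᵀ) − (QP)Ḧ(PQᵀ)`, into the C-jet loops of the L-sector `−tr(ΞC₂) + 2tr(ΞC₁GC₁) − tr(ΞC₁ΞC₁)` (`G = (blockProp H Q)⁻¹`) gives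
`−2tr(R̃ḢPḢ) + tr(R̃Ḧ) + 2tr(R̃ḢR^QḢ) − tr(R̃ḢR̃Ḣ)` with `R̃ = (H⁻¹Qᵀ)·Ξ·(QH⁻¹)`, `R^Q = minMap H Q·Q·H⁻¹` — for ANY `Ξ`. -/
theorem lsector_pureH_eq (H H₁ H₂ : Matrix ν ν ℝ) (Q : Matrix μ ν ℝ) (Ξ : Matrix μ μ ℝ) :
    -(Ξ * ((2 : ℝ) • ((Q * H⁻¹) * H₁ * H⁻¹ * H₁ * (H⁻¹ * Qᵀ)) - (Q * H⁻¹) * H₂ * (H⁻¹ * Qᵀ))).trace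
      + 2 * (Ξ * (-((Q * H⁻¹) * H₁ * (H⁻¹ * Qᵀ))) * (blockProp H Q)⁻¹ * (-((Q * H⁻¹) * H₁ * (H⁻¹ * Qᵀ)))).trace
      - (Ξ * (-((Q * H⁻¹) * H₁ * (H⁻¹ * Qᵀ))) * (Ξ * (-((Q * H⁻¹) * H₁ * (H⁻¹ * Qᵀ))))).trace
      = -2 * (H⁻¹ * Qᵀ * Ξ * (Q * H⁻¹) * H₁ * H⁻¹ * H₁).trace + (H⁻¹ * Qᵀ * Ξ * (Q * H⁻¹) * H₂).trace
        + 2 * (H⁻¹ * Qᵀ * Ξ * (Q * H⁻¹) * H₁ * (minMap H Q * Q * H⁻¹) * H₁).trace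
        - (H⁻¹ * Qᵀ * Ξ * (Q * H⁻¹) * H₁ * (H⁻¹ * Qᵀ * Ξ * (Q * H⁻¹) * H₁)).trace := by
  -- the four monomials
  have m1 : (Ξ * ((Q * H⁻¹) * H₁ * H⁻¹ * H₁ * (H⁻¹ * Qᵀ))).trace = (H⁻¹ * Qᵀ * Ξ * (Q * H⁻¹) * H₁ * H⁻¹ * H₁).trace := by
    rw [show (Q * H⁻¹) * H₁ * H⁻¹ * H₁ * (H⁻¹ * Qᵀ) = (Q * H⁻¹) * (H₁ * H⁻¹ * H₁) * (H⁻¹ * Qᵀ) by simp only [Matrix.mul_assoc],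
      trace_xi_sandwich]
    simp only [Matrix.mul_assoc]
  have m2 : (Ξ * ((Q * H⁻¹) * H₂ * (H⁻¹ * Qᵀ))).trace = (H⁻¹ * Qᵀ * Ξ * (Q * H⁻¹) * H₂).trace := trace_xi_sandwich H Q Ξ H₂
  have m3 : (Ξ * ((Q * H⁻¹) * H₁ * (H⁻¹ * Qᵀ)) * (blockProp H Q)⁻¹ * ((Q * H⁻¹) * H₁ * (H⁻¹ * Qᵀ))).trace
      = (H⁻¹ * Qᵀ * Ξ * (Q * H⁻¹) * H₁ * (minMap H Q * Q * H⁻¹) * H₁).trace := by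
    rw [← range_term_eq, show Ξ * ((Q * H⁻¹) * H₁ * (H⁻¹ * Qᵀ)) * (blockProp H Q)⁻¹ * ((Q * H⁻¹) * H₁ * (H⁻¹ * Qᵀ))
        = Ξ * ((Q * H⁻¹) * (H₁ * (H⁻¹ * Qᵀ * (blockProp H Q)⁻¹ * (Q * H⁻¹)) * H₁) * (H⁻¹ * Qᵀ)) by simp only [Matrix.mul_assoc],
      trace_xi_sandwich]
    simp only [Matrix.mul_assoc]
  have m4 : (Ξ * ((Q * H⁻¹) * H₁ * (H⁻¹ * Qᵀ)) * (Ξ * ((Q * H⁻¹) * H₁ * (H⁻¹ * Qᵀ)))).trace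
      = (H⁻¹ * Qᵀ * Ξ * (Q * H⁻¹) * H₁ * (H⁻¹ * Qᵀ * Ξ * (Q * H⁻¹) * H₁)).trace := by
    rw [show Ξ * ((Q * H⁻¹) * H₁ * (H⁻¹ * Qᵀ)) * (Ξ * ((Q * H⁻¹) * H₁ * (H⁻¹ * Qᵀ)))
        = (Ξ * (Q * H⁻¹) * H₁ * (H⁻¹ * Qᵀ * Ξ * (Q * H⁻¹) * H₁)) * (H⁻¹ * Qᵀ) by simp only [Matrix.mul_assoc], Matrix.trace_mul_comm]
    simp only [Matrix.mul_assoc]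
  simp only [Matrix.mul_sub, Matrix.mul_smul, Matrix.mul_neg, Matrix.neg_mul, neg_neg, Matrix.trace_sub, Matrix.trace_smul,
    smul_eq_mul]
  rw [m1, m2, m3, m4]
  ring

end Summit.QuantumFields.BalabanUV.Beta.FP.InducedPolarizationRegroup

end
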